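import Summits.Ventures.PercRepro.ProfilePointedCircuitClassesStarNine

/-!
# PercRepro — THE THREE-SERIES-PAIR REGIME OF THE TWELVE-POINT STATEMENT, IN THE KERNEL MODULO (★) AT `(11, 6)`
WITH TWO DISJOINT SERIES PAIRS (p5, gen 51; `proofs/P5-GM1.md` §78 ADDENDUM 1)

§78 proves by exhaustion over the complete catalogue of nine-element matroids that `in_5(e) ≤ out_6(e)` holds at
every point `e` of a `12`-point rank-`7` matroid avoided by THREE disjoint series pairs (95,867,856 configurations,
0 violations, slack `≥ 16`).  The kernel-side dependency of that regime is isolated here: §66's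
`inCount_five_le_outCount_six_of_seriesPair_of_star` turns the statement at `e` into (★) at `(e, a')` on `N ／ a`
(eleven points, rank `6`), and `N ／ a` keeps the two other series pairs `{b, b'}`, `{c, c'}`.  The eleven-point
inequality (★) — `in_5(e) ≤ in_5(f) + thru_5({e, f})` — is FALSE in general (§66 ADD 3, the pencil family) but
EXHAUSTIVELY TRUE on every eleven-point rank-`6` matroid with two disjoint series pairs avoiding `e, f` (neither a
coloop): the series extensions of all 190,214 rank-`4` nine-element matroids at two points, 286,381,102 ordered
configurations, 0 violations, min slack 0 (kit j327057, §78 ADD 1).  That statement is the Prop **`StarElevenTwoPairs`**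
(a CONJECTURE def, NOT asserted); **`inCount_five_le_outCount_six_of_three_seriesPairs_of_starElevenTwoPairs`**
derives the regime from it.
-/

open scoped Matroid

namespace PercRepro.Cogirth

open Finset ThmH Skew Shadow Profile

variable {α : Type} [DecidableEq α] {N : Matroid α} [N.Finite]

section StarElevenTwoPairs

/-- **(★) AT `(11, 6)` WITH TWO DISJOINT SERIES PAIRS** (a CONJECTURE `Prop`, NOT asserted): on every matroid with
`#E = 11`, `ρ(E) = 6`, series pairs `{b, b'}` and `{c, c'}` (four distinct points) and two further distinct points
`e, f` outside them, neither a coloop, `in_5(e) ≤ in_5(f) + thru_5({e, f})`.  Exhaustively true on the complete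
catalogue (§78 ADD 1). -/
def StarElevenTwoPairs (α : Type) [DecidableEq α] : Prop :=
  ∀ (N : Matroid α) [N.Finite], (gr N).card = 11 → rk N (gr N) = 6 →
    ∀ b b' c c' e f : α, SeriesPair N b b' → SeriesPair N c c' → b ≠ c → b ≠ c' → b' ≠ c → b' ≠ c' →
      e ∈ gr N → f ∈ gr N → e ≠ f → e ≠ b → e ≠ b' → e ≠ c → e ≠ c' → f ≠ b → f ≠ b' → f ≠ c → f ≠ c' →
      rk N ((gr N).erase e) = 6 → rk N ((gr N).erase f) = 6 →
      inCount N 5 e ≤ inCount N 5 f + thruCount N 5 {e, f}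

/-- **THE THREE-SERIES-PAIR REGIME MODULO `StarElevenTwoPairs`**: on `#E = 12`, `ρ(E) = 7`, with three disjoint series
pairs `{a, a'}`, `{b, b'}`, `{c, c'}` and a point `e` outside them that is not a coloop, `in_5(e) ≤ out_6(e)` follows
from (★) at `(e, a')` on `N ／ a`, which `StarElevenTwoPairs` supplies (the pairs `{b, b'}`, `{c, c'}` survive the
contraction; `a'` is not a coloop of `N ／ a` since `ρ(E − a') = ρ(E)`). -/
theorem inCount_five_le_outCount_six_of_three_seriesPairs_of_starElevenTwoPairs (hS : StarElevenTwoPairs α)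
    (hn : (gr N).card = 12) (hR : rk N (gr N) = 7) {a a' b b' c c' e : α} (h : SeriesPair N a a')
    (h' : SeriesPair N b b') (h'' : SeriesPair N c c') (hab : a ≠ b) (hab' : a ≠ b') (hac : a ≠ c) (hac' : a ≠ c')
    (ha'b : a' ≠ b) (ha'b' : a' ≠ b') (ha'c : a' ≠ c) (ha'c' : a' ≠ c') (hbc : b ≠ c) (hbc' : b ≠ c') (hb'c : b' ≠ c)
    (hb'c' : b' ≠ c') (he : e ∈ gr N) (hea : e ≠ a) (hea' : e ≠ a') (heb : e ≠ b) (heb' : e ≠ b') (hec : e ≠ c)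
    (hec' : e ≠ c') (hce : rk N ((gr N).erase e) = 7) : inCount N 5 e ≤ outCount N 6 e := by
  have ha : a ∈ gr N := h.1
  have ha' : a' ∈ gr N := h.2.1
  have haa' : a ≠ a' := h.2.2.1
  have hind := indep_singleton_of_seriesPair h
  have hgr : gr (N ／ ({a} : Set α)) = (gr N).erase a := gr_contract'
  have hn' : (gr (N ／ ({a} : Set α))).card = 11 := by
    rw [hgr, card_erase_of_mem ha, hn]
  have hE := rk_gr_contract_add_one hind ha
  have hR' : rk (N ／ ({a} : Set α)) (gr (N ／ ({a} : Set α))) = 6 := by omega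
  have hser1 : SeriesPair (N ／ ({a} : Set α)) b b' := seriesPair_contract_of_ne h' ha hab hab' hind
  have hser2 : SeriesPair (N ／ ({a} : Set α)) c c' := seriesPair_contract_of_ne h'' ha hac hac' hind
  have he' : e ∈ gr (N ／ ({a} : Set α)) := by rw [hgr]; exact mem_erase.2 ⟨hea, he⟩
  have ha'' : a' ∈ gr (N ／ ({a} : Set α)) := by rw [hgr]; exact mem_erase.2 ⟨haa'.symm, ha'⟩
  -- `e` and `a'` are not coloops of `N ／ a`
  have hce' : rk (N ／ ({a} : Set α)) ((gr (N ／ ({a} : Set α))).erase e) = 6 := by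
    have h1 := rk_contract_add_one hind (X := ((gr N).erase a).erase e) (erase_subset _ _)
    have e1 : insert a (((gr N).erase a).erase e) = (gr N).erase e := by
      rw [erase_right_comm, insert_erase (mem_erase.2 ⟨hea.symm, ha⟩)]
    rw [e1, hce] at h1
    rw [hgr]
    omega
  have hca' : rk (N ／ ({a} : Set α)) ((gr (N ／ ({a} : Set α))).erase a') = 6 := by
    have h1 := rk_contract_add_one hind (X := ((gr N).erase a).erase a') (erase_subset _ _)
    have e1 : insert a (((gr N).erase a).erase a') = (gr N).erase a' := by
      rw [erase_right_comm, insert_erase (mem_erase.2 ⟨haa', ha⟩)]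
    rw [e1, h.2.2.2.2.1, hR] at h1
    rw [hgr]
    omega
  have hstar := hS (N ／ ({a} : Set α)) hn' hR' b b' c c' e a' hser1 hser2 hbc hbc' hb'c hb'c' he' ha'' hea' heb
    heb' hec hec' ha'b ha'b' ha'c ha'c' hce' hca'
  exact inCount_five_le_outCount_six_of_seriesPair_of_star hn hR h he hea hea' hstar

end StarElevenTwoPairs

end PercRepro.Cogirth
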